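import Literature.MathematicalPhysics.QuantumFieldTheory.Balaban1983to89.B1TorusCubeContours
import Literature.MathematicalPhysics.QuantumFieldTheory.Balaban1983to89.B4Eq12ExpFlow
import Literature.MathematicalPhysics.QuantumFieldTheory.Balaban1983to89.B4Eq220CubeField

/-!
# `Balaban1983to89.B1TorusCubeBoxOp` — THE CUBE OPERATOR «Δ_{□_j}(Ã_j) = −Δ^{η,N}_{Ã_j,□_j} + m² + aP(Ã_j)» OF
# [Balaban1983RegularityDecay] §2 FOR THE (Higgs)₂,₃ MODEL OF [Balaban1982Higgs1] (2.20) IS, ALONG THE CUBE CHART, THE BOX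
# OPERATOR `H(□, Ã)` OF THE CELL'S LEMMA-2.2 LINEAGE (`B4Lemma22ReduceZero.opA`): the flow `U = e^{qεeA}` as an `OrthFlow`,
# the field dictionary, the intertwining identity, `G_j ↔ greenA`, `K_jG_jh_j ↔ kOp·greenA·mulH`, and the PER-CUBE INPUTS
# (2.17)/(2.20) of the torus random walk `B1TorusCubeLocality26.norm_propagatorK_univ_le` from the lineage's box theorems

statement-level skeleton of published theorems with citation tags; proofs where landed; nothing here is a claim about the Yang–Mills mass gap

CITATION HEADER (lean-in-tree rule).  T. Bałaban, *Regularity and decay of lattice Green's functions*, Commun. Math. Phys. **89**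
(1983) 571–597 [Balaban1983RegularityDecay] ((1.2)–(1.6) p. 572 the operator, Lemma 2.2 (2.17) p. 578, (2.20) p. 578, §2
p. 575 `Ã_j`) and T. Bałaban, *(Higgs)₂,₃ quantum fields in a finite volume. I*, Commun. Math. Phys. **85** (1982) 603–626
[Balaban1982Higgs1] ((1.7) p. 605 `U(A) = exp(qεeA)`, (2.20) p. 610, Prop. 2.1 (2.23)–(2.25) pp. 610–611).  Cell `lit-balaban`,
Phase-2 proof seat **p35** gen 8 (unit `lit-balaban-p35`); SKELETON rows **B4.Lem2.2** / **B4.Eq2.18** ((2.17)/(2.20) per-cube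
inputs ON THE (Higgs)₂,₃ TORUS CUBES), **B4.Thm@573**, **B1.Prop2.1**.  USED BY NAME, never restated: the typer's `HiggsLattice`
(`ChargeData.U`), `HiggsCovariance.{covOpK, propagatorK, covLaplacianN, projPk}`, `HiggsCovariancePos`, r01's lineage
(`B4GaugeCovariance.{OrthFlow, fieldLink, covLap, covLapKer, avgOp, projOp, covOp, b4Op, blockOp, fld, transport, contourTrans}`,
`B4Eq12ExpFlow.{expFlow, expFlow_lipschitz}`, `B4Lemma22ReduceZero.{Box, opA, greenA}`, `B4Lemma22Invertible.{opA_isUnit_det,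
greenA_mul_opA}`, `B4Lemma22CrossSup.lemma22_17_sup_box`, `B4Eq220FactorField.eq220_sup_box`, `B4Eq220CommutatorField.kOp`,
`B4CubeFields22.cubeField`, `B4CubeFieldHyps22.{cubeField_hyps, cubeField_threshold, aSeq_window, kOp_smul, greenA_smul,
smul_cubeField}`, `B4Eq220PartitionSizes.{hBox, hsize_hBox}`), this seat's `B1TorusCubeCover`/`Locality26`/`Chart`/`Contours`.

WHAT IS PRINTED.  [B4] p. 572: *«U(A) = e^{qeηA}, q is an antisymmetric N × N matrix … (−Δ^η_A φ)(x) … (Q_k(A)φ)(y) =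
Σ_{x∈B^k(y)} η^d U(A(Γ^{(k)}_{y,x}))φ(x) … G_k(Ω, A) = (−Δ^{η,N}_{A,Ω} + m² + aP_k(A))^{−1} (1.6)»*; p. 578 (2.17), (2.20)
(quoted in `B4Eq220CubeField`).  [B1] p. 610: *«G_k(Ω, A) = (−Δ^{η,N}_{A,Ω} + m²(L^kε)² + a_kP_k(A))^{−1} (2.22)»*, p. 611 (2.25).

WHAT THIS FILE PROVES (kernel-checked, zero `sorry`; definitions with bodies + theorems; no `def … : Prop` fact).
* §1 `qMat` (the matrix of `q`), `qMat_transpose` (`qᵀ = −q`), `toEuclideanCLM_exp`, `flowC = expFlow qMat`, **`ofLp_U`** /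
  `ofLp_star_U` (`U(εeA)v = e^{(εeA)q}v` read on `Fin N → ℝ`).
* §2 `acT` (the component field `σ·A(toT y)`), `boxField = cubeField □ n K₀ 1 (acT 0) acT`; `hTor_toT`/`thetaTor_toT` (the bumps
  along the chart are the lineage's `hBox`/`thetaZ`), `pull_hsmul_hTor`, **`boxField_step`** (`κ·boxField(y, y+e_i) = εe·Ã_j(⟨toT y, i⟩)`
  when `κσ = εe`).
* §3 `fld_covLap_boxWt` (the covariant box Laplacian at a site), `sum_nbrs_box` (neighbour sums split by direction).
* §4 **THE INTERTWINING** `opA_mulVec_pull`: `H(□, boxField) (pull ψ) = pull ((L^Kε)²·H_j ψ)` for every field `ψ` on `T_ε`.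
* §5 `pull_propagatorK` (`pull(G_jφ) = (L^Kε)²·greenA·pull φ`), `pull_commutator` (`pull(H_j(h_ju) − h_jH_ju) = −(L^Kε)^{−2}·kOp·pull u`).
* §6 **`cube_inputs`** — for constants `Cγ, Cβ` (from Lemma 2.2 at charge 1) and, given `(creg, β, K₀)`, a threshold `e₁`: for
  every admissible instance with `0 < e_c ≤ e₁` and `acT` (1.7)-regular, BOTH per-cube inputs of the torus walk hold:
  `‖G_j(h_jψ)‖_∞ ≤ Cγ(L^Kε)²‖ψ‖_∞` and `‖H_j(h_jG_j(h_jψ)) − h_jH_jG_j(h_jψ)‖_∞ ≤ (Cβ/K₀)‖ψ‖_∞`.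
HONEST SCOPE.  (i) Hypotheses `K ≤ K_P`, `K ≥ 1`, `K₀ ∣ M_P`, `K₀ ≥ 8`, `3M ≤ |T_ε|_μ`, `L ≥ 2`, `m² > 0`, `a` in a window;
(ii) the regularity of the background enters as the lineage's (1.7)-hypothesis on `acT` (lattice units, effective charge `e_c`,
scale `σ = L^Kε·e/e_c`), to be supplied by the consumer; (iii) constants depend on `(d, N, q, L, a₋, a₊, m²₊)`, `e₁` also on
`(creg, β, K₀)`.  Unit `lit-balaban-p35` gen 8 (literature-prover-lit-balaban-p35-g8-0); v1.1 (gen 11,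
doc-only): citeloc P39-002 at `acT` — display (1.7) is printed on p. 572 of CMP 89 (p. 573 opens «and c is some universal constant»).
-/

open scoped BigOperators Matrix

noncomputable section

namespace Literature.MathematicalPhysics.QuantumFieldTheory.Balaban1983to89.B1TorusCubeBoxOp

open Matrix (toEuclideanCLM)
open Literature.MathematicalPhysics.QuantumFieldTheory.Balaban1983to89.HiggsLattice
open Literature.MathematicalPhysics.QuantumFieldTheory.Balaban1983to89.HiggsAveraging
open Literature.MathematicalPhysics.QuantumFieldTheory.Balaban1983to89.HiggsCovariance
open Literature.MathematicalPhysics.QuantumFieldTheory.Balaban1983to89.HiggsCovariancePos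
  (shift_unshift unshift_shift isUnit_covOpK covOpK_mul_propagatorK covOpK_propagatorK_apply)
open Literature.MathematicalPhysics.QuantumFieldTheory.Balaban1983to89.B1TorusCubeCover
open Literature.MathematicalPhysics.QuantumFieldTheory.Balaban1983to89.B1TorusCubeLocality26
open Literature.MathematicalPhysics.QuantumFieldTheory.Balaban1983to89.B1TorusCubeChart
open Literature.MathematicalPhysics.QuantumFieldTheory.Balaban1983to89.B1TorusCubeContours
open Literature.MathematicalPhysics.QuantumFieldTheory.Balaban1983to89.B4GaugeCovariance
open Literature.MathematicalPhysics.QuantumFieldTheory.Balaban1983to89.B4Commutators25to211 (mulH fld_mulH_mulVec)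
open Literature.MathematicalPhysics.QuantumFieldTheory.Balaban1983to89.B4Reflection242 (boxDom mem_boxDom blk nbrs mem_nbrs
  nbrs_comm blk_mem_boxDom)
open Literature.MathematicalPhysics.QuantumFieldTheory.Balaban1983to89.B4Lower18Regular (e1 e1_apply_self e1_apply_ne
  lsum PathRel baseEmb abs_lsum_le blkWt_ne_zero)
open Literature.MathematicalPhysics.QuantumFieldTheory.Balaban1983to89.B4Lower18RegularRegion (compField compField_add e1_inj)
open Literature.MathematicalPhysics.QuantumFieldTheory.Balaban1983to89.B4Lemma21Region (siteNorm)
open Literature.MathematicalPhysics.QuantumFieldTheory.Balaban1983to89.B4Lemma22Reduce231 (supN le_supN supN_le supN_nonneg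
  siteNorm_nonneg)
open Literature.MathematicalPhysics.QuantumFieldTheory.Balaban1983to89.B4Lemma22PertVSup (contourTrans_fieldLink
  fld_avgOp_transpose_mulVec supN_neg supN_smul_le)
open Literature.MathematicalPhysics.QuantumFieldTheory.Balaban1983to89.B4Lemma22ReduceZero (Box opA greenA)
open Literature.MathematicalPhysics.QuantumFieldTheory.Balaban1983to89.B4Lemma22Invertible (opA_isUnit_det greenA_mul_opA)
open Literature.MathematicalPhysics.QuantumFieldTheory.Balaban1983to89.B4Eq12ExpFlow (expFlow expFlow_U expFlow_lipschitz)
open Literature.MathematicalPhysics.QuantumFieldTheory.Balaban1983to89.B4PartitionUnity22 (hprof thetaProf hCube thetaCube D1 D2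
  D1_nonneg D2_nonneg contDiff_hprof hasCompactSupport_hprof contDiff_thetaProf hasCompactSupport_thetaProf)
open Literature.MathematicalPhysics.QuantumFieldTheory.Balaban1983to89.B4Eq220PartitionSizes (hZ hBox hsize_hBox)
open Literature.MathematicalPhysics.QuantumFieldTheory.Balaban1983to89.B4CubeFields22 (thetaZ cubeField cubeFluct cubeField_step
  cubeField_antisymm)
open Literature.MathematicalPhysics.QuantumFieldTheory.Balaban1983to89.B4CubeFieldHyps22 (cubeField_hyps cubeField_threshold
  aSeq_window kOp_smul greenA_smul smul_cubeField)
open Literature.MathematicalPhysics.QuantumFieldTheory.Balaban1983to89.B4Eq220CommutatorField (kOp kOp_eq_opA supN_mulH_le)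
open Literature.MathematicalPhysics.QuantumFieldTheory.Balaban1983to89.B4Eq220FactorField (eq220_sup_box)
open Literature.MathematicalPhysics.QuantumFieldTheory.Balaban1983to89.B4Lemma22CrossSup (lemma22_17_sup_box)

variable {P : HiggsLattice.Params} {N : ℕ}

/-! ## §1 The flow `U = e^{tq}` of (1.2)/(1.7) as an `OrthFlow` of the matrix of `q` -/

section Flow

variable (C : ChargeData N)

/-- THE MATRIX OF `q` («q is an antisymmetric N × N matrix»). [cite: Balaban1983RegularityDecay, (1.2) p.572] -/
def qMat : Matrix (Fin N) (Fin N) ℝ := (Matrix.toEuclideanCLM (𝕜 := ℝ) (n := Fin N)).symm C.q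

/-- The matrix represents `q`. [cite: Balaban1983RegularityDecay, (1.2) p.572] -/
theorem toEuclideanCLM_qMat : Matrix.toEuclideanCLM (𝕜 := ℝ) (n := Fin N) (qMat C) = C.q := by
  rw [qMat, StarAlgEquiv.apply_symm_apply]

set_option synthInstance.maxHeartbeats 80000 in
/-- «q is an antisymmetric matrix»: `qᵀ = −q` (from `q* = −q`, [B1] p. 605). [cite: Balaban1983RegularityDecay, (1.2) p.572] -/
theorem qMat_transpose : (qMat C)ᵀ = -qMat C := by
  have h1 : Matrix.toEuclideanCLM (𝕜 := ℝ) (n := Fin N) (star (qMat C)) = star C.q := by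
    rw [map_star, toEuclideanCLM_qMat]
  rw [C.q_skew, ← toEuclideanCLM_qMat C, ← map_neg] at h1
  have h2 := (Matrix.toEuclideanCLM (𝕜 := ℝ) (n := Fin N)).injective h1
  rwa [Matrix.star_eq_conjTranspose, Matrix.conjTranspose_eq_transpose_of_trivial] at h2

/-- The matrix exponential is carried to the operator exponential (continuous algebra isomorphism). [cite: Balaban1983RegularityDecay, (1.2) p.572] -/
theorem toEuclideanCLM_exp (X : Matrix (Fin N) (Fin N) ℝ) :
    Matrix.toEuclideanCLM (𝕜 := ℝ) (n := Fin N) (NormedSpace.exp X)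
      = NormedSpace.exp (Matrix.toEuclideanCLM (𝕜 := ℝ) (n := Fin N) X) := by
  open scoped Matrix.Norms.L2Operator in
  letI : NormedAlgebra ℚ (Matrix (Fin N) (Fin N) ℝ) := .restrictScalars ℚ ℝ _
  letI : NormedAlgebra ℚ (EuclideanSpace ℝ (Fin N) →L[ℝ] EuclideanSpace ℝ (Fin N)) := .restrictScalars ℚ ℝ _
  refine NormedSpace.map_exp (Matrix.toEuclideanCLM (𝕜 := ℝ) (n := Fin N)) ?_ X
  exact AddMonoidHomClass.continuous_of_bound _ 1 (fun A => by simp [Matrix.l2_opNorm_toEuclideanCLM])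

/-- THE FLOW `t ↦ e^{tq}` of the model's charge matrix, as an `OrthFlow` of the lineage. [cite: Balaban1983RegularityDecay, (1.2) p.572] -/
def flowC : OrthFlow (Fin N) := expFlow (qMat C) (qMat_transpose C)

/-- The Lipschitz constant `ℓ₁ = (Σ q_{ij}²)^{1/2}` of the flow (the lineage's `hLip`). [cite: Balaban1983RegularityDecay, (1.2) p.572] -/
def ellC : ℝ := Real.sqrt (∑ i, ∑ j, qMat C i j ^ 2)

/-- `0 ≤ ℓ₁`. [cite: Balaban1983RegularityDecay, (1.2) p.572] -/
theorem ellC_nonneg : 0 ≤ ellC C := Real.sqrt_nonneg _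

/-- `hLip` for the model's flow. [cite: Balaban1983RegularityDecay, (1.2) p.572] -/
theorem flowC_lipschitz (t : ℝ) (v : Fin N → ℝ) :
    (((flowC C).U t - 1) *ᵥ v) ⬝ᵥ (((flowC C).U t - 1) *ᵥ v) ≤ (ellC C * t) ^ 2 * (v ⬝ᵥ v) :=
  expFlow_lipschitz (qMat C) (qMat_transpose C) t v

/-- **`U(ηeA)v = e^{(ηeA)q}v`** on coordinates: the model's link variable acting on `ℝ^N` is the lineage's flow matrix.
[cite: Balaban1982Higgs1, (1.7) p.605] [cite: Balaban1983RegularityDecay, (1.2) p.572] -/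
theorem ofLp_U (η a : ℝ) (v : EuclideanSpace ℝ (Fin N)) :
    WithLp.ofLp (C.U η a v) = (flowC C).U (η * C.e * a) *ᵥ WithLp.ofLp v := by
  have hU : C.U η a = Matrix.toEuclideanCLM (𝕜 := ℝ) (n := Fin N) ((flowC C).U (η * C.e * a)) := by
    rw [flowC, expFlow_U, toEuclideanCLM_exp, map_smul, toEuclideanCLM_qMat]
    rfl
  rw [hU, Matrix.ofLp_toEuclideanCLM]

/-- `U(ηeA)* v = (e^{(ηeA)q})ᵀ v`. [cite: Balaban1982Higgs1, (1.7) p.605] -/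
theorem ofLp_star_U (η a : ℝ) (v : EuclideanSpace ℝ (Fin N)) :
    WithLp.ofLp (star (C.U η a) v) = ((flowC C).U (η * C.e * a))ᵀ *ᵥ WithLp.ofLp v := by
  rw [ChargeData.star_U, ofLp_U, (flowC C).transpose_eq]
  congr 2; ring

end Flow

/-! ## §2 The field dictionary: `Ã_j` on the box, the bumps along the chart -/

section Field

variable (K K₀ : ℕ)

/-- The component field of the lineage: `acT σ A y i = σ·A(⟨toT y, i⟩)` (scale `σ`). [cite: Balaban1983RegularityDecay, (1.7) p.572] -/
def acT (j : Lab P K K₀) (σ : ℝ) (A : HiggsLattice.VecField P 0) : (Fin (dd P + 1) → ℤ) → Fin (dd P + 1) → ℝ :=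
  fun y i => σ * A ⟨toT K K₀ j y, castD P i⟩

/-- THE BOX FIELD: the lineage's `Ã = A₀ + θA′` built from `acT` with `A₀ = acT 0` (the corner `Mj − M`) and label `1`.
[cite: Balaban1983RegularityDecay, §2 p.575] -/
def boxField (j : Lab P K K₀) (σ : ℝ) (A : HiggsLattice.VecField P 0) :
    ↥(Box (dd P) (P.L - 1) K (M2 P K₀)) → ↥(Box (dd P) (P.L - 1) K (M2 P K₀)) → ℝ :=
  cubeField (Box (dd P) (P.L - 1) K (M2 P K₀)) ((P.L - 1 + 1) ^ K) K₀ (fun _ => 1) (acT K K₀ j σ A 0) (acT K K₀ j σ A)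

variable {K K₀}

/-- The real cube size: `M = (L−1+1)^K·K₀` as reals. [cite: Balaban1983RegularityDecay, §2 p.575] -/
theorem half_cast (P : HiggsLattice.Params) (K K₀ : ℕ) : (half P K K₀ : ℝ) = (((P.L - 1 + 1) ^ K : ℕ) : ℝ) * K₀ := by
  rw [predL_succ]; unfold half; push_cast; ring

/-- **`h_j` ALONG THE CHART IS THE LINEAGE'S `hBox`** (label `1`): `h_j(toT y) = hBox n K₀ M 1 y`, `y ∈ □`.
[cite: Balaban1983RegularityDecay, §2 p.575] -/
theorem hTor_toT (hK : K ≤ P.K) (hK₀ : K₀ ∣ P.M) (hK₀' : 1 ≤ K₀) (j : Lab P K K₀)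
    (y : ↥(Box (dd P) (P.L - 1) K (M2 P K₀))) :
    hTor K K₀ j (toT K K₀ j y.1) = hBox ((P.L - 1 + 1) ^ K) K₀ (M2 P K₀) (fun _ => 1) y := by
  have hy := (mem_box_iff y.1).1 y.2
  have hy' : ∀ μ, 0 ≤ vecT y.1 μ ∧ vecT y.1 μ < 2 * half P K K₀ := fun μ => hy _
  unfold toT
  rw [hTor_chart hK hK₀ hK₀' j hy']
  unfold hBox hZ hCube
  rw [← (castD P).prod_comp]
  refine Finset.prod_congr rfl fun i _ => ?_
  rw [vecT_castD, half_cast]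
  push_cast
  rw [div_div]

/-- **`θ_j` ALONG THE CHART IS THE LINEAGE'S `thetaZ`** (label `1`), `y ∈ □`. [cite: Balaban1983RegularityDecay, §2 p.575] -/
theorem thetaTor_toT (hK : K ≤ P.K) (hK₀ : K₀ ∣ P.M) (hK₀' : 1 ≤ K₀) (j : Lab P K K₀) {y : Fin (dd P + 1) → ℤ}
    (hy : y ∈ Box (dd P) (P.L - 1) K (M2 P K₀)) :
    thetaTor K K₀ j (toT K K₀ j y) = thetaZ ((P.L - 1 + 1) ^ K) K₀ (fun _ => 1) y := by
  have hy1 := (mem_box_iff y).1 hy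
  have hy' : ∀ μ, 0 ≤ vecT y μ ∧ vecT y μ < 2 * half P K K₀ := fun μ => hy1 _
  unfold toT
  rw [thetaTor_chart hK hK₀ hK₀' j hy']
  unfold thetaZ thetaCube
  rw [← (castD P).prod_comp]
  refine Finset.prod_congr rfl fun i _ => ?_
  rw [vecT_castD, half_cast]
  push_cast
  rw [div_div]

/-- `pull (h_j·ψ) = mulH(hBox)·pull ψ`. [cite: Balaban1983RegularityDecay, (2.9) p.576] -/
theorem pull_hsmul_hTor (hK : K ≤ P.K) (hK₀ : K₀ ∣ P.M) (hK₀' : 1 ≤ K₀) (j : Lab P K K₀) (ψ : HiggsLattice.ScalarField P 0 N) :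
    pull K K₀ j (hTor K K₀ j • ψ) = mulH (hBox ((P.L - 1 + 1) ^ K) K₀ (M2 P K₀) (fun _ => 1)) *ᵥ pull K K₀ j ψ := by
  funext p
  obtain ⟨y, i⟩ := p
  have h := congrFun (fld_mulH_mulVec (ι := Fin N) (hBox ((P.L - 1 + 1) ^ K) K₀ (M2 P K₀) (fun _ => 1)) (pull K K₀ j ψ) y) i
  simp only [fld_apply] at h
  rw [h, Pi.smul_apply, fld_apply, pull_hsmul, hTor_toT hK hK₀ hK₀' j y, smul_eq_mul]

/-- `boxField = cubeField …` restricted values depend on the underlying points only: the raw pair function. [cite: Balaban1983RegularityDecay, (2.6) p.576] -/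
def boxPair (K K₀ : ℕ) (j : Lab P K K₀) (σ : ℝ) (A : HiggsLattice.VecField P 0) (u v : Fin (dd P + 1) → ℤ) : ℝ :=
  constBond (acT K K₀ j σ A 0) id u v
    + thetaZ ((P.L - 1 + 1) ^ K) K₀ (fun _ => 1) (u ⊓ v) * (compField (acT K K₀ j σ A) u v - constBond (acT K K₀ j σ A 0) id u v)

/-- `boxField u v = boxPair u.1 v.1`. [cite: Balaban1983RegularityDecay, (2.6) p.576] -/
theorem boxField_eq_boxPair (j : Lab P K K₀) (σ : ℝ) (A : HiggsLattice.VecField P 0) (u v : ↥(Box (dd P) (P.L - 1) K (M2 P K₀))) :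
    boxField K K₀ j σ A u v = boxPair K K₀ j σ A u.1 v.1 := rfl

/-- The raw pair function on a forward bond: `boxPair(z, z + e_i) = A₀,i + θ(z)(acT z i − A₀,i)`. [cite: Balaban1983RegularityDecay, §2 p.575] -/
theorem boxPair_step (j : Lab P K K₀) (σ : ℝ) (A : HiggsLattice.VecField P 0) (z : Fin (dd P + 1) → ℤ) (i : Fin (dd P + 1)) :
    boxPair K K₀ j σ A z (z + e1 i)
      = acT K K₀ j σ A 0 i + thetaZ ((P.L - 1 + 1) ^ K) K₀ (fun _ => 1) z * (acT K K₀ j σ A z i - acT K K₀ j σ A 0 i) := by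
  unfold boxPair
  have hc : constBond (acT K K₀ j σ A 0) id z (z + e1 i) = acT K K₀ j σ A 0 i := by
    unfold constBond
    simp only [id, Pi.add_apply]
    rw [Finset.sum_eq_single i]
    · rw [e1_apply_self]; push_cast; ring
    · intro b _ hb; rw [e1_apply_ne hb]; push_cast; ring
    · intro h; exact absurd (Finset.mem_univ i) h
  have hinf : z ⊓ (z + e1 i) = z := inf_eq_left.2 fun k => by
    rw [Pi.add_apply]
    by_cases hk : k = i
    · subst hk; rw [e1_apply_self]; linarith
    · rw [e1_apply_ne hk]; linarith
  rw [hc, hinf, compField_add]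

/-- **THE FIELD DICTIONARY ON BONDS**: `boxPair(z, z + e_i) = σ·Ã_j(⟨toT z, i⟩)` for `z ∈ □` (corner constant `A(Mj − M)`).
[cite: Balaban1983RegularityDecay, §2 p.575] -/
theorem boxPair_step_eq (hK : K ≤ P.K) (hK₀ : K₀ ∣ P.M) (hK₀' : 1 ≤ K₀) (j : Lab P K K₀) (σ : ℝ) (A : HiggsLattice.VecField P 0)
    {z : Fin (dd P + 1) → ℤ} (hz : z ∈ Box (dd P) (P.L - 1) K (M2 P K₀)) (i : Fin (dd P + 1)) :
    boxPair K K₀ j σ A z (z + e1 i) = σ * cubeVec K K₀ j A ⟨toT K K₀ j z, castD P i⟩ := by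
  rw [boxPair_step, ← thetaTor_toT hK hK₀ hK₀' j hz]
  unfold acT cubeVec cornerSite toT
  have : vecT (0 : Fin (dd P + 1) → ℤ) = (0 : Fin P.d → ℤ) := by funext μ; rfl
  rw [this]
  ring

/-- `κ·boxField(y, y + e_i) = εe·Ã_j(⟨toT y, i⟩)` when `κσ = εe`. [cite: Balaban1983RegularityDecay, (1.2) p.572] -/
theorem boxField_fwd (hK : K ≤ P.K) (hK₀ : K₀ ∣ P.M) (hK₀' : 1 ≤ K₀) (j : Lab P K K₀) {κ σ : ℝ} (C : ChargeData N)
    (hκσ : κ * σ = P.mesh 0 * C.e) (A : HiggsLattice.VecField P 0) {u v : ↥(Box (dd P) (P.L - 1) K (M2 P K₀))} {i : Fin (dd P + 1)}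
    (huv : v.1 = u.1 + e1 i) :
    κ * boxField K K₀ j σ A u v = P.mesh 0 * C.e * cubeVec K K₀ j A ⟨toT K K₀ j u.1, castD P i⟩ := by
  rw [boxField_eq_boxPair, huv, boxPair_step_eq hK hK₀ hK₀' j σ A u.2, ← mul_assoc, hκσ]

/-- `κ·boxField(v + e_i ↦ v)`: the backward bond carries `−εe·Ã_j(⟨toT v, i⟩)`. [cite: Balaban1983RegularityDecay, p.576 «A_b̄ = −A_b»] -/
theorem boxField_bwd (hK : K ≤ P.K) (hK₀ : K₀ ∣ P.M) (hK₀' : 1 ≤ K₀) (j : Lab P K K₀) {κ σ : ℝ} (C : ChargeData N)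
    (hκσ : κ * σ = P.mesh 0 * C.e) (A : HiggsLattice.VecField P 0) {u v : ↥(Box (dd P) (P.L - 1) K (M2 P K₀))} {i : Fin (dd P + 1)}
    (huv : u.1 = v.1 + e1 i) :
    κ * boxField K K₀ j σ A u v = -(P.mesh 0 * C.e * cubeVec K K₀ j A ⟨toT K K₀ j v.1, castD P i⟩) := by
  rw [boxField, cubeField_antisymm, ← boxField, mul_neg, boxField_fwd hK hK₀ hK₀' j C hκσ A huv]

end Field

/-! ## §3 The covariant box Laplacian at a site; neighbour sums by direction -/

section Laplacian

variable {ι : Type} [Fintype ι] [DecidableEq ι] {d : ℕ}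

/-- **THE COVARIANT NEUMANN BOX LAPLACIAN AT A SITE**: for [B4]'s bond weights `n²/2` on ordered nearest-neighbour pairs inside the
box and the link variables `U(κA)` of an antisymmetric `A`,
`(−Δ Φ)(z) = n² Σ_{z′ ∼ z, z′ ∈ □} (φ(z) − U(κA(z,z′))φ(z′))`. [cite: Balaban1983RegularityDecay, (1.3) p.572] -/
theorem fld_covLap_boxWt (F : OrthFlow ι) (κ : ℝ) {n : ℕ} {NM : Fin (d + 1) → ℕ}
    (A' : ↥(boxDom NM) → ↥(boxDom NM) → ℝ) (hanti : ∀ u v, A' v u = -A' u v) (Φ : ↥(boxDom NM) × ι → ℝ)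
    (z : ↥(boxDom NM)) :
    fld (covLap (boxWt n NM) (fieldLink F κ A') *ᵥ Φ) z
      = ((n : ℝ) ^ 2) • ∑ z' : ↥(boxDom NM),
          (if z'.1 ∈ nbrs z.1 then (fld Φ z - fieldLink F κ A' z z' *ᵥ fld Φ z') else 0) := by
  rw [covLap_eq_blockOp, fld_blockOp_mulVec]
  -- symmetric weights, orthogonal links, `W(z',z)ᵀ = W(z,z')`
  have hc : ∀ x y : ↥(boxDom NM), boxWt n NM x y = boxWt n NM y x := fun x y => by
    unfold boxWt; congr 1; by_cases h : y.1 ∈ nbrs x.1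
    · rw [if_pos h, if_pos (nbrs_comm.1 h)]
    · rw [if_neg h, if_neg (fun h' => h (nbrs_comm.1 h'))]
  have horth : ∀ x y : ↥(boxDom NM), (fieldLink F κ A' x y)ᵀ * fieldLink F κ A' x y = 1 := fun x y => F.orth _
  have hrev : ∀ x y : ↥(boxDom NM), (fieldLink F κ A' x y)ᵀ = fieldLink F κ A' y x := fun x y => by
    unfold fieldLink; rw [F.transpose_eq, hanti x y, mul_neg]
  have hker : ∀ z' : ↥(boxDom NM), covLapKer (boxWt n NM) (fieldLink F κ A') z z'
      = (if z = z' then (2 * ∑ y, boxWt n NM z y) • (1 : Matrix ι ι ℝ) else 0)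
        - (2 * boxWt n NM z z') • fieldLink F κ A' z z' := by
    intro z'
    unfold covLapKer
    simp only [horth]
    simp only [hrev, hc z' z]
    by_cases h : z = z'
    · subst h
      rw [if_pos rfl, if_pos rfl, if_pos rfl]
      have e : ∑ x, boxWt n NM x z • (1 : Matrix ι ι ℝ) = ∑ y, boxWt n NM z y • (1 : Matrix ι ι ℝ) :=
        Finset.sum_congr rfl fun x _ => by rw [hc x z]
      rw [e, ← Finset.sum_smul, two_mul, add_smul, two_mul, add_smul]
      abel
    · rw [if_neg h, if_neg h, if_neg h, two_mul, add_smul]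
      abel
  simp_rw [hker, Matrix.sub_mulVec, Finset.sum_sub_distrib]
  rw [Finset.sum_eq_single z (fun z' _ hz' => by rw [if_neg (Ne.symm hz'), Matrix.zero_mulVec])
    (fun h => absurd (Finset.mem_univ z) h), if_pos rfl, Matrix.smul_mulVec, Matrix.one_mulVec,
    Finset.mul_sum, Finset.sum_smul, ← Finset.sum_sub_distrib, Finset.smul_sum]
  -- `2·boxWt z z' = n²·1[z' ∼ z]`
  have hw : ∀ z' : ↥(boxDom NM), 2 * boxWt n NM z z' = (n : ℝ) ^ 2 * (if z'.1 ∈ nbrs z.1 then 1 else 0) := fun z' => by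
    unfold boxWt; ring
  refine Finset.sum_congr rfl fun z' _ => ?_
  rw [Matrix.smul_mulVec, hw z']
  by_cases h : z'.1 ∈ nbrs z.1
  · rw [if_pos h, if_pos h, mul_one, smul_sub]
  · rw [if_neg h, if_neg h, mul_zero, zero_smul, zero_smul, sub_zero, smul_zero]

/-- **NEIGHBOUR SUMS SPLIT BY DIRECTION**: `Σ_{z′ ∈ □, z′ ∼ y} g(z′) = Σ_i (1[y + e_i ∈ □]g(y + e_i) + 1[y − e_i ∈ □]g(y − e_i))`.
[cite: Balaban1983RegularityDecay, (1.3) p.572] -/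
theorem sum_nbrs_box {M' : Type*} [AddCommMonoid M'] {NM : Fin (d + 1) → ℕ} (y : Fin (d + 1) → ℤ)
    (g : (Fin (d + 1) → ℤ) → M') :
    ∑ z' : ↥(boxDom NM), (if z'.1 ∈ nbrs y then g z'.1 else 0)
      = ∑ i : Fin (d + 1), ((if y + e1 i ∈ boxDom NM then g (y + e1 i) else 0)
          + (if y - e1 i ∈ boxDom NM then g (y - e1 i) else 0)) := by
  classical
  rw [Finset.sum_coe_sort (boxDom NM) (fun w => if w ∈ nbrs y then g w else 0), ← Finset.sum_filter]
  have hset : (boxDom NM).filter (fun w => w ∈ nbrs y) = (nbrs y).filter (fun w => w ∈ boxDom NM) := by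
    ext w; simp only [Finset.mem_filter]; tauto
  rw [hset, Finset.sum_filter]
  -- `nbrs y` is the disjoint union of the two injective images
  have hinj₁ : Set.InjOn (fun i : Fin (d + 1) => y + Pi.single i 1) (Finset.univ : Finset (Fin (d + 1))) := by
    intro i _ i' _ h
    have h' : (Pi.single i 1 : Fin (d + 1) → ℤ) = Pi.single i' 1 := add_left_cancel h
    exact e1_inj.1 h'
  have hinj₂ : Set.InjOn (fun i : Fin (d + 1) => y - Pi.single i 1) (Finset.univ : Finset (Fin (d + 1))) := by
    intro i _ i' _ h
    have h' : (Pi.single i 1 : Fin (d + 1) → ℤ) = Pi.single i' 1 := sub_right_injective h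
    exact e1_inj.1 h'
  have hdisj : Disjoint (Finset.univ.image fun i : Fin (d + 1) => y + Pi.single i 1)
      (Finset.univ.image fun i : Fin (d + 1) => y - Pi.single i 1) := by
    rw [Finset.disjoint_left]
    intro w hw1 hw2
    rw [Finset.mem_image] at hw1 hw2
    obtain ⟨i, -, rfl⟩ := hw1
    obtain ⟨i', -, h⟩ := hw2
    have := congrFun h i
    simp only [Pi.add_apply, Pi.sub_apply, Pi.single_apply] at this
    split_ifs at this <;> omega
  unfold nbrs
  rw [Finset.sum_union hdisj, Finset.sum_image hinj₁, Finset.sum_image hinj₂, ← Finset.sum_add_distrib]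
  rfl

end Laplacian

/-! ## §4 The intertwining identity `H(□, boxField)·pull = pull·(L^Kε)²H_j` -/

section Intertwine

variable {K K₀ : ℕ}

/-- THE BOX OPERATOR OF THE CUBE in the lineage: `H(□, boxField)` with [B4]'s weights, the flow `e^{tq}`, coupling `κ`, mass
`m²(L^Kε)²` and the composite-contour system `gammaT`. [cite: Balaban1983RegularityDecay, (1.6) p.572] -/
abbrev boxOp (C : ChargeData N) (K K₀ : ℕ) (j : Lab P K K₀) (κ σ a msq : ℝ) (A : HiggsLattice.VecField P 0) :
    Matrix (↥(Box (dd P) (P.L - 1) K (M2 P K₀)) × Fin N) (↥(Box (dd P) (P.L - 1) K (M2 P K₀)) × Fin N) ℝ :=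
  opA (dd P) (flowC C) κ (P.L - 1) K a (msq * P.mesh K ^ 2) (M2 P K₀) (baseEmb (one_le_n P K) (M2 P K₀))
    (gammaT P K K₀) (boxField K K₀ j σ A)

/-- `fld (pull φ) z` is the coordinate vector of `φ(toT z)`. [cite: Balaban1983RegularityDecay, §2 p.575] -/
theorem fld_pull_ofLp (j : Lab P K K₀) (φ : HiggsLattice.ScalarField P 0 N) (z : ↥(Box (dd P) (P.L - 1) K (M2 P K₀))) :
    fld (pull K K₀ j φ) z = WithLp.ofLp (φ (toT K K₀ j z.1)) := rfl

/-- `(L^Kε)²·ε^{−2} = n²`, `n = L^K`. [cite: Balaban1982Higgs1, (1.19) p.607] -/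
theorem mesh_sq_ratio (P : HiggsLattice.Params) (K : ℕ) :
    P.mesh K ^ 2 * (P.mesh 0)⁻¹ ^ 2 = ((((P.L - 1 + 1) ^ K : ℕ)) : ℝ) ^ 2 := by
  rw [predL_succ]
  unfold HiggsLattice.Params.mesh
  have hε := P.hε
  push_cast
  field_simp

/-- `3M ≤ |T_ε|` and `M ≥ 2` under `K₀ ≥ 8`. [cite: Balaban1983RegularityDecay, §2 p.575] -/
theorem two_le_half (hK₀8 : 8 ≤ K₀) : 2 ≤ half P K K₀ := by
  unfold half
  have : 1 ≤ P.L ^ K := Nat.one_le_pow _ _ P.hL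
  nlinarith

/-- **(T1) THE LAPLACIAN PART**: `−Δ_{U(κ·boxField)}(pull ψ) = pull((L^Kε)²·(−Δ^{ε,N}_{Ã_j,□_j})ψ)`.
[cite: Balaban1983RegularityDecay, (1.3) p.572] [cite: Balaban1982Higgs1, (2.17) p.610] -/
theorem covLap_pull (C : ChargeData N) (hK : K ≤ P.K) (hK₀ : K₀ ∣ P.M) (hK₀8 : 8 ≤ K₀)
    (hN3 : ∀ μ, 3 * half P K K₀ ≤ P.sitesPerDir 0 μ) (j : Lab P K K₀) {κ σ : ℝ} (hκσ : κ * σ = P.mesh 0 * C.e)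
    (A : HiggsLattice.VecField P 0) (ψ : HiggsLattice.ScalarField P 0 N) (z : ↥(Box (dd P) (P.L - 1) K (M2 P K₀))) :
    fld (covLap (boxWt ((P.L - 1 + 1) ^ K) (fun i => (P.L - 1 + 1) ^ K * M2 P K₀ i))
        (fieldLink (flowC C) κ (boxField K K₀ j σ A)) *ᵥ pull K K₀ j ψ) z
      = fld (pull K K₀ j ((P.mesh K ^ 2) • covLaplacianN C (cube K K₀ j) (cubeVec K K₀ j A) ψ)) z := by
  have hK₀' : 1 ≤ K₀ := le_trans (by norm_num) hK₀8
  have hh2 : 2 ≤ half P K K₀ := two_le_half hK₀8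
  have hanti : ∀ u v : ↥(Box (dd P) (P.L - 1) K (M2 P K₀)), boxField K K₀ j σ A v u = -boxField K K₀ j σ A u v :=
    fun u v => cubeField_antisymm _ _ _ _ _ u v
  rw [fld_covLap_boxWt (flowC C) κ (boxField K K₀ j σ A) hanti (pull K K₀ j ψ) z]
  -- the summand factors through the underlying points
  set x : HiggsLattice.Site P 0 := toT K K₀ j z.1 with hx
  set g : (Fin (dd P + 1) → ℤ) → (Fin N → ℝ) := fun w =>
    WithLp.ofLp (ψ x) - (flowC C).U (κ * boxPair K K₀ j σ A z.1 w) *ᵥ WithLp.ofLp (ψ (toT K K₀ j w)) with hg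
  have hsum : ∀ z' : ↥(Box (dd P) (P.L - 1) K (M2 P K₀)),
      (if z'.1 ∈ nbrs z.1 then (fld (pull K K₀ j ψ) z - fieldLink (flowC C) κ (boxField K K₀ j σ A) z z' *ᵥ
        fld (pull K K₀ j ψ) z') else 0) = (if z'.1 ∈ nbrs z.1 then g z'.1 else 0) := by
    intro z'; split_ifs
    · rfl
    · rfl
  rw [Finset.sum_congr rfl (fun z' _ => hsum z'), sum_nbrs_box z.1 g]
  -- the torus side
  rw [fld_pull_ofLp, Pi.smul_apply, covLaplacianN_apply, WithLp.ofLp_smul, WithLp.ofLp_smul, smul_smul,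
    mesh_sq_ratio, WithLp.ofLp_sum, ← (castD P).sum_comp]
  congr 1
  refine Finset.sum_congr rfl fun i _ => ?_
  rw [WithLp.ofLp_add, fwdTerm_apply, bwdTerm_apply]
  have hxc : x ∈ cube K K₀ j := toT_mem_cube hK hK₀ hK₀' j z.2
  congr 1
  · -- forward bond
    rw [← hx]
    by_cases hb : z.1 + e1 i ∈ Box (dd P) (P.L - 1) K (M2 P K₀)
    · have hs : x.shift (castD P i) ∈ cube K K₀ j := (add_e1_mem_box_iff hK hK₀ hK₀' hN3 hh2 j z.2 i).1 hb
      rw [if_pos hb, if_pos ⟨hxc, hs⟩, hg]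
      simp only
      rw [WithLp.ofLp_sub, ofLp_U, ← toT_add_e1, hx]
      congr 3
      have := boxField_fwd hK hK₀ hK₀' j C hκσ A (u := z) (v := ⟨z.1 + e1 i, hb⟩) rfl
      rw [boxField_eq_boxPair] at this
      rw [this]
    · have hs : x.shift (castD P i) ∉ cube K K₀ j := fun h => hb ((add_e1_mem_box_iff hK hK₀ hK₀' hN3 hh2 j z.2 i).2 h)
      rw [if_neg hb, if_neg (fun h => hs h.2), WithLp.ofLp_zero]
  · -- backward bond
    rw [← hx]
    by_cases hb : z.1 - e1 i ∈ Box (dd P) (P.L - 1) K (M2 P K₀)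
    · have hs : x.unshift (castD P i) ∈ cube K K₀ j := (sub_e1_mem_box_iff hK hK₀ hK₀' hN3 hh2 j z.2 i).1 hb
      rw [if_pos hb, if_pos ⟨hxc, hs⟩, hg]
      simp only
      rw [WithLp.ofLp_sub, ofLp_star_U, ← toT_sub_e1, hx, (flowC C).transpose_eq]
      congr 3
      have := boxField_bwd hK hK₀ hK₀' j C hκσ A (u := z) (v := ⟨z.1 - e1 i, hb⟩) (i := i) (by simp)
      rw [boxField_eq_boxPair] at this
      rw [this]
    · have hs : x.unshift (castD P i) ∉ cube K K₀ j :=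
        fun h => hb ((sub_e1_mem_box_iff hK hK₀ hK₀' hN3 hh2 j z.2 i).2 h)
      rw [if_neg hb, if_neg (fun h => hs h.2), WithLp.ofLp_zero]

/-- `blk` at the lineage's `(L−1+1)^K` is `blk` at `L^K`. [cite: Balaban1982Higgs1, (2.2) p.608] -/
theorem blk_predL (z : Fin (dd P + 1) → ℤ) : blk ((P.L - 1 + 1) ^ K) z = blk (nK P K) z := by
  rw [predL_succ]

/-- `L^K ≤ |T_ε|_μ` from `3M ≤ |T_ε|_μ`. [cite: Balaban1982Higgs1, (1.2) p.604] -/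
theorem pow_le_sites (hK₀' : 1 ≤ K₀) (hN3 : ∀ μ, 3 * half P K K₀ ≤ P.sitesPerDir 0 μ) (μ : Fin P.d) :
    P.L ^ K ≤ P.sitesPerDir 0 μ := by
  have h := hN3 μ; unfold half at h; nlinarith [Nat.one_le_pow K P.L P.hL]

/-- **THE TRANSPORTERS OF THE CUBE'S CONTOUR SYSTEM ARE THE MODEL'S `U(Ã_j(Γ^{(K)}_{x_K,x}))`** (for `x ∈ B^K(y)`).
[cite: Balaban1983RegularityDecay, (1.4) p.572] [cite: Balaban1982Higgs1, (2.11) p.609] -/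
theorem contourTrans_gammaT (C : ChargeData N) (hK : K ≤ P.K) (hK₀ : K₀ ∣ P.M) (hK₀' : 1 ≤ K₀)
    (hN3 : ∀ μ, 3 * half P K K₀ ≤ P.sitesPerDir 0 μ) (j : Lab P K K₀) {κ σ : ℝ} (hκσ : κ * σ = P.mesh 0 * C.e)
    (A : HiggsLattice.VecField P 0) (y : ↥(boxDom (M2 P K₀))) (x : ↥(Box (dd P) (P.L - 1) K (M2 P K₀)))
    (h : blk ((P.L - 1 + 1) ^ K) x.1 = y.1) :
    contourTrans (fieldLink (flowC C) κ (boxField K K₀ j σ A)) (baseEmb (one_le_n P K) (M2 P K₀)) (gammaT P K K₀) y x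
      = (flowC C).U (P.mesh 0 * C.e * multiContourSum (cubeVec K K₀ j A) K (toT K K₀ j x.1)) := by
  rw [contourTrans_fieldLink]
  rw [blk_predL] at h
  rw [lsum_gammaT hK (pow_le_sites hK₀' hN3) j (cubeVec K K₀ j A) σ (boxField K K₀ j σ A) (boxPair K K₀ j σ A)
    (boxField_eq_boxPair j σ A) (fun z hz i => boxPair_step_eq hK hK₀ hK₀' j σ A hz i) y x h, ← mul_assoc, hκσ]

/-- `n^{dd+1}·(L^{K·d})^{−1} = 1` (`n = L^K`, `d = dd + 1`). [cite: Balaban1982Higgs1, (2.2) p.608] -/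
theorem pow_weight_cancel (P : HiggsLattice.Params) (K : ℕ) :
    ((((P.L - 1 + 1) ^ K : ℕ)) : ℝ) ^ (dd P + 1) * (((P.L : ℝ) ^ (K * P.d))⁻¹) = 1 := by
  rw [predL_succ, ← dd_succ P]
  have hL : (0 : ℝ) < P.L := by exact_mod_cast P.hL
  push_cast
  rw [← pow_mul, mul_inv_cancel₀ (by positivity)]

/-- **(T3) THE AVERAGING PART**: `Q^*Q(pull ψ) = n^{d}·pull(P_K(Ã_j)ψ)` (unit block weights on the box against `L^{−Kd}` on the torus).
[cite: Balaban1983RegularityDecay, (1.4)–(1.5) p.572] [cite: Balaban1982Higgs1, (2.20) p.610] -/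
theorem projOp_pull (C : ChargeData N) (hK : K ≤ P.K) (hK₀ : K₀ ∣ P.M) (hK₀8 : 8 ≤ K₀)
    (hN3 : ∀ μ, 3 * half P K K₀ ≤ P.sitesPerDir 0 μ) (j : Lab P K K₀) {κ σ : ℝ} (hκσ : κ * σ = P.mesh 0 * C.e)
    (A : HiggsLattice.VecField P 0) (ψ : HiggsLattice.ScalarField P 0 N) (z : ↥(Box (dd P) (P.L - 1) K (M2 P K₀))) :
    fld (projOp (blkWt ((P.L - 1 + 1) ^ K) (M2 P K₀) (fun i => (P.L - 1 + 1) ^ K * M2 P K₀ i))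
        (contourTrans (fieldLink (flowC C) κ (boxField K K₀ j σ A)) (baseEmb (one_le_n P K) (M2 P K₀)) (gammaT P K K₀))
        *ᵥ pull K K₀ j ψ) z
      = fld (pull K K₀ j (((((P.L - 1 + 1) ^ K : ℕ) : ℝ) ^ (dd P + 1)) • projPk C (cubeVec K K₀ j A) K ψ)) z := by
  classical
  have hK₀' : 1 ≤ K₀ := le_trans (by norm_num) hK₀8
  have hh2 : 2 ≤ half P K K₀ := two_le_half hK₀8
  set n : ℕ := (P.L - 1 + 1) ^ K with hn
  set T := contourTrans (fieldLink (flowC C) κ (boxField K K₀ j σ A)) (baseEmb (one_le_n P K) (M2 P K₀)) (gammaT P K K₀)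
    with hT
  set x : HiggsLattice.Site P 0 := toT K K₀ j z.1 with hx
  set t : HiggsLattice.Site P 0 → ℝ := fun w => P.mesh 0 * C.e * multiContourSum (cubeVec K K₀ j A) K w with ht
  have hT' : ∀ (y : ↥(boxDom (M2 P K₀))) (z' : ↥(Box (dd P) (P.L - 1) K (M2 P K₀))), blk n z'.1 = y.1 →
      T y z' = (flowC C).U (t (toT K K₀ j z'.1)) := fun y z' h => contourTrans_gammaT C hK hK₀ hK₀' hN3 j hκσ A y z' h
  set yz : ↥(boxDom (M2 P K₀)) := ⟨blk n z.1, blk_mem_boxDom (one_le_n P K) z.2⟩ with hyz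
  -- the box side
  rw [projOp, ← Matrix.mulVec_mulVec, fld_avgOp_transpose_mulVec]
  rw [Finset.sum_eq_single yz ?_ (fun h => absurd (Finset.mem_univ yz) h)]
  swap
  · intro y₀ _ hy₀
    have : blkWt n (M2 P K₀) (fun i => n * M2 P K₀ i) y₀ z = 0 := by
      unfold blkWt; rw [if_neg]; intro h; exact hy₀ (Subtype.ext h.symm)
    rw [this, zero_smul]
  have hq : blkWt n (M2 P K₀) (fun i => n * M2 P K₀ i) yz z = 1 := by unfold blkWt; rw [if_pos rfl]
  rw [hq, one_smul, fld_avgOp_mulVec, hT' yz z rfl]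
  have hterm : ∀ z' : ↥(Box (dd P) (P.L - 1) K (M2 P K₀)),
      blkWt n (M2 P K₀) (fun i => n * M2 P K₀ i) yz z' • (T yz z' *ᵥ fld (pull K K₀ j ψ) z')
        = if blk n z'.1 = blk n z.1 then (flowC C).U (t (toT K K₀ j z'.1)) *ᵥ WithLp.ofLp (ψ (toT K K₀ j z'.1)) else 0 := by
    intro z'
    unfold blkWt
    by_cases h : blk n z'.1 = blk n z.1
    · rw [if_pos h, if_pos h, one_smul, hT' yz z' h, fld_pull_ofLp]
    · rw [if_neg h, if_neg h, zero_smul]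
  rw [Finset.sum_congr rfl (fun z' _ => hterm z')]
  -- the torus side
  rw [fld_pull_ofLp, Pi.smul_apply, WithLp.ofLp_smul, projPk_apply, ofLp_star_U, WithLp.ofLp_smul, Matrix.mulVec_smul,
    smul_smul, pow_weight_cancel, one_smul, WithLp.ofLp_sum]
  simp_rw [ofLp_U]
  congr 1
  -- the block sums correspond under the chart
  rw [← Finset.sum_filter]
  refine Finset.sum_bij' (fun z' _ => toT K K₀ j z'.1) (fun x' hx' => ⟨fromT K K₀ j x', ?_⟩) ?_ ?_ ?_ ?_ ?_
  · -- `x' ∈ B^K(x_K)` lies in the cube, so its box coordinates are in the box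
    rw [mem_blockK] at hx'
    exact (mem_cube_iff hK hK₀ hK₀' j x').1
      (mem_cube_of_blockIter_eq hK hK₀ hK₀' hN3 j (toT_mem_cube hK hK₀ hK₀' j z.2) hx')
  · intro z' hz'
    rw [Finset.mem_filter] at hz'
    rw [mem_blockK]
    have : blk (nK P K) z'.1 = blk (nK P K) z.1 := by rw [← blk_predL, ← blk_predL]; exact hz'.2
    exact (blockIter_toT_eq_iff hK hN3 j z'.2 z.2).2 this
  · intro x' hx'
    rw [Finset.mem_filter]
    refine ⟨Finset.mem_univ _, ?_⟩
    rw [mem_blockK] at hx'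
    have hmem := (mem_cube_iff hK hK₀ hK₀' j x').1
      (mem_cube_of_blockIter_eq hK hK₀ hK₀' hN3 j (toT_mem_cube hK hK₀ hK₀' j z.2) hx')
    have := (blockIter_toT_eq_iff hK hN3 j hmem z.2).1 (by rw [toT_fromT]; exact hx')
    show blk n (fromT K K₀ j x') = blk n z.1
    rw [hn, blk_predL, blk_predL]; exact this
  · intro z' hz'; exact Subtype.ext (fromT_toT_of_mem hK hK₀ hK₀' j z'.2)
  · intro x' hx'; exact toT_fromT j x'
  · intro z' hz'; rfl

/-- **THE INTERTWINING IDENTITY**: along the chart, the lineage's box operator of the cube is `(L^Kε)²` times the model's cube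
operator of (2.20): `H(□, boxField)(pull ψ) = pull((L^Kε)²·(−Δ^{ε,N}_{Ã_j,□_j} + m² + a_K(L^Kε)^{−2}P_K(Ã_j))ψ)` for EVERY `ψ`.
[cite: Balaban1983RegularityDecay, (1.6) p.572] [cite: Balaban1982Higgs1, (2.20), (2.22) p.610] -/
theorem opA_mulVec_pull (C : ChargeData N) (hK : K ≤ P.K) (hK₀ : K₀ ∣ P.M) (hK₀8 : 8 ≤ K₀)
    (hN3 : ∀ μ, 3 * half P K K₀ ≤ P.sitesPerDir 0 μ) (j : Lab P K K₀) {κ σ : ℝ} (hκσ : κ * σ = P.mesh 0 * C.e)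
    (a msq : ℝ) (A : HiggsLattice.VecField P 0) (ψ : HiggsLattice.ScalarField P 0 N) :
    boxOp C K K₀ j κ σ a msq A *ᵥ pull K K₀ j ψ
      = pull K K₀ j ((P.mesh K ^ 2) • covOpK C (cube K K₀ j) (cubeVec K K₀ j A) msq a K ψ) := by
  have hm : P.mesh K ≠ 0 := by
    have : 0 < P.mesh K := by unfold HiggsLattice.Params.mesh; have := P.hε; have := P.hL; positivity
    exact this.ne'
  have hn : ((((P.L - 1 + 1) ^ K : ℕ)) : ℝ) ≠ 0 := by have := P.hL; positivity
  have hL : ((P.L - 1 : ℕ) : ℝ) + 1 = (P.L : ℝ) := by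
    have := predL_succ P; exact_mod_cast this
  funext p
  obtain ⟨z, i⟩ := p
  have e1 := congrFun (covLap_pull C hK hK₀ hK₀8 hN3 j hκσ A ψ z) i
  have e3 := congrFun (projOp_pull C hK hK₀ hK₀8 hN3 j hκσ A ψ z) i
  simp only [fld_apply] at e1 e3
  simp only [boxOp, opA, b4Op, covOp, Matrix.add_mulVec, Matrix.smul_mulVec, Matrix.one_mulVec, Pi.add_apply,
    Pi.smul_apply, e1, e3, smul_eq_mul]
  simp only [pull, covOpK, LinearMap.add_apply, LinearMap.smul_apply, LinearMap.id_apply, Pi.add_apply, Pi.smul_apply,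
    smul_eq_mul, PiLp.add_apply, PiLp.smul_apply, hL]
  field_simp

end Intertwine


/-! ## §5 `G_j ↔ greenA` and `K_jG_j h_j ↔ kOp·greenA·mulH` -/

section GreenDict

variable {K K₀ : ℕ}

/-- The lineage's `hend` for the cube's contour system. [cite: Balaban1982Higgs1, (2.2) p.608] -/
theorem gammaT_hend (y : ↥(boxDom (M2 P K₀))) (x : ↥(Box (dd P) (P.L - 1) K (M2 P K₀)))
    (h : blkWt ((P.L - 1 + 1) ^ K) (M2 P K₀) (fun i => (P.L - 1 + 1) ^ K * M2 P K₀ i) y x ≠ 0) :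
    pathEnd (baseEmb (one_le_n P K) (M2 P K₀) y) (gammaT P K K₀ y x) = x := by
  have hb := blkWt_ne_zero h
  rw [blk_predL] at hb
  exact gammaT_end y x hb

/-- `0 ≤ a_K` in the model's normalisation (`a > 0`, `L ≥ 2`, `K ≥ 1`). [cite: Balaban1982Higgs1, (2.15) p.609] -/
theorem aSeq_nonneg_model (hL2 : 2 ≤ P.L) {a : ℝ} (ha : 0 < a) (hK1 : 1 ≤ K) : 0 ≤ B1.aSeq a P.L K := by
  have hL : (1 : ℝ) < (P.L : ℝ) := by exact_mod_cast hL2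
  exact (B1.aSeq_pos ha hL hK1).le

/-- **`G_j` ALONG THE CHART IS `(L^Kε)²·G(□, boxField)`**: `pull(G_jφ) = (L^Kε)²·greenA·pull φ` for every `φ`.
[cite: Balaban1983RegularityDecay, (1.6) p.572] [cite: Balaban1982Higgs1, (2.22) p.610] -/
theorem pull_propagatorK (C : ChargeData N) (hK : K ≤ P.K) (hK1 : 1 ≤ K) (hK₀ : K₀ ∣ P.M) (hK₀8 : 8 ≤ K₀)
    (hN3 : ∀ μ, 3 * half P K K₀ ≤ P.sitesPerDir 0 μ) (hL2 : 2 ≤ P.L) (j : Lab P K K₀) {κ σ : ℝ}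
    (hκσ : κ * σ = P.mesh 0 * C.e) {a msq : ℝ} (ha : 0 < a) (hmsq : 0 < msq) (A : HiggsLattice.VecField P 0)
    (φ : HiggsLattice.ScalarField P 0 N) :
    pull K K₀ j (propagatorK C (cube K K₀ j) (cubeVec K K₀ j A) msq a K φ)
      = (P.mesh K ^ 2) • (greenA (dd P) (flowC C) κ (P.L - 1) K a (msq * P.mesh K ^ 2) (M2 P K₀)
          (baseEmb (one_le_n P K) (M2 P K₀)) (gammaT P K K₀) (boxField K K₀ j σ A) *ᵥ pull K K₀ j φ) := by
  have hak : 0 ≤ B1.aSeq a P.L K := aSeq_nonneg_model hL2 ha hK1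
  have hℓ : 1 ≤ P.L - 1 := by omega
  have hm2 : 0 ≤ msq * P.mesh K ^ 2 := by positivity
  have h1 := opA_mulVec_pull C hK hK₀ hK₀8 hN3 j hκσ a msq A (propagatorK C (cube K K₀ j) (cubeVec K K₀ j A) msq a K φ)
  rw [covOpK_propagatorK_apply C _ _ hmsq a K hak] at h1
  have hinv := greenA_mul_opA (flowC C) κ hℓ hK1 ha hm2 (M2 P K₀) (fun y x _ => gammaT_nn y x)
    (fun y x h => gammaT_hend y x h) (boxField K K₀ j σ A)
  have h2 := congrArg (fun v => greenA (dd P) (flowC C) κ (P.L - 1) K a (msq * P.mesh K ^ 2) (M2 P K₀)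
    (baseEmb (one_le_n P K) (M2 P K₀)) (gammaT P K K₀) (boxField K K₀ j σ A) *ᵥ v) h1
  rw [Matrix.mulVec_mulVec, hinv, Matrix.one_mulVec, pull_smul, Matrix.mulVec_smul] at h2
  exact h2

/-- **`K_j` ALONG THE CHART**: `pull(H_j(h_ju) − h_jH_ju) = −(L^Kε)^{−2}·kOp·pull u` for every `u`.
[cite: Balaban1983RegularityDecay, (2.7)–(2.10) p.576] -/
theorem pull_commutator (C : ChargeData N) (hK : K ≤ P.K) (hK₀ : K₀ ∣ P.M) (hK₀8 : 8 ≤ K₀)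
    (hN3 : ∀ μ, 3 * half P K K₀ ≤ P.sitesPerDir 0 μ) (j : Lab P K K₀) {κ σ : ℝ} (hκσ : κ * σ = P.mesh 0 * C.e)
    (a msq : ℝ) (A : HiggsLattice.VecField P 0) (u : HiggsLattice.ScalarField P 0 N) :
    pull K K₀ j (covOpK C (cube K K₀ j) (cubeVec K K₀ j A) msq a K (hTor K K₀ j • u)
        - hTor K K₀ j • covOpK C (cube K K₀ j) (cubeVec K K₀ j A) msq a K u)
      = -((P.mesh K ^ 2)⁻¹ • (kOp (flowC C) κ ((P.L - 1 + 1) ^ K) (B1.aSeq a (((P.L - 1 : ℕ) : ℝ) + 1) K)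
          (msq * P.mesh K ^ 2) (M2 P K₀) (baseEmb (one_le_n P K) (M2 P K₀)) (gammaT P K K₀) (boxField K K₀ j σ A)
          (hBox ((P.L - 1 + 1) ^ K) K₀ (M2 P K₀) (fun _ => 1)) *ᵥ pull K K₀ j u)) := by
  have hK₀' : 1 ≤ K₀ := le_trans (by norm_num) hK₀8
  have hs : P.mesh K ≠ 0 := by
    have : 0 < P.mesh K := by unfold HiggsLattice.Params.mesh; have := P.hε; have := P.hL; positivity
    exact this.ne'
  rw [kOp_eq_opA, Matrix.sub_mulVec, ← Matrix.mulVec_mulVec, ← Matrix.mulVec_mulVec]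
  change _ = -((P.mesh K ^ 2)⁻¹ • (mulH (hBox ((P.L - 1 + 1) ^ K) K₀ (M2 P K₀) (fun _ => 1))
      *ᵥ (boxOp C K K₀ j κ σ a msq A *ᵥ pull K K₀ j u)
      - boxOp C K K₀ j κ σ a msq A *ᵥ (mulH (hBox ((P.L - 1 + 1) ^ K) K₀ (M2 P K₀) (fun _ => 1)) *ᵥ pull K K₀ j u)))
  rw [← pull_hsmul_hTor hK hK₀ hK₀' j u, opA_mulVec_pull C hK hK₀ hK₀8 hN3 j hκσ,
    opA_mulVec_pull C hK hK₀ hK₀8 hN3 j hκσ, ← pull_hsmul_hTor hK hK₀ hK₀' j]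
  funext p
  simp only [pull, Pi.sub_apply, Pi.neg_apply, Pi.smul_apply, PiLp.sub_apply, PiLp.smul_apply, smul_eq_mul,
    Pi.smul_apply']
  field_simp
  ring

end GreenDict

/-! ## §6 The per-cube inputs (2.17)/(2.20) of the torus random walk -/

section Inputs

variable {K K₀ : ℕ}

/-- `h_jψ` is supported in `□_j` (`K₀ ≥ 8`). [cite: Balaban1983RegularityDecay, §2 p.575] -/
theorem hTor_smul_eq_zero_off (hK : K ≤ P.K) (hK₀ : K₀ ∣ P.M) (hK₀8 : 8 ≤ K₀) (j : Lab P K K₀)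
    (ψ : HiggsLattice.ScalarField P 0 N) {x : HiggsLattice.Site P 0} (hx : x ∉ cube K K₀ j) : (hTor K K₀ j • ψ) x = 0 := by
  have h0 : hTor K K₀ j x = 0 := by
    by_contra h
    exact hx (mem_cube_of_near hK₀8 (near_rS_of_hTor_ne_zero hK hK₀ hK₀8 h) ⟨0, P.hd⟩).1
  rw [Pi.smul_apply', h0, zero_smul]

set_option maxHeartbeats 800000 in
/-- **THE PER-CUBE INPUTS OF THE TORUS RANDOM WALK FROM THE LINEAGE'S LEMMA 2.2** — «‖G_k(□_j,Ã_j)h_jψ‖ ≤ O(1)‖ψ‖» ((2.17)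
sup member, in the model's units `O(1)(L^Kε)²`) and «‖K_jG_k(□_j,Ã_j)h_j‖ ≤ c₂O(1)M⁻¹» ((2.20)), ON THE CUBES OF THE (Higgs)₂,₃
TORUS, with only «e sufficiently small».  QUANTIFIER ORDER: constants `Cγ, Cβ > 0` first (Lemma 2.2 at charge 1 for the flow
`e^{tq}`: they depend on `d, N, q, L, a₋, a₊, m²₊`); then for the regularity pair `(creg, β)` and the cube size `K₀ ≥ 8` a threshold
`e₁`; then the instance: the torus (`K ≥ 1`, `K ≤ K_P`, `K₀ ∣ M_P`, `3M ≤ |T_ε|`), `a ∈ [a₋, a₊]`, `m² > 0` with `m²(L^Kε)² ≤ m²₊`,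
the label `j`, ANY vector field `A` on `T_ε` whose scaled components `acT` (scale `σ = L^Kε·e/e_c`) are (1.7)-regular on the box,
and the effective charge `0 < e_c ≤ e₁`.  CONCLUSION: both hypotheses `hGj` (γ = Cγ(L^Kε)²) and `hKj` (β = Cβ/K₀) of
`B1TorusCubeLocality26.norm_propagatorK_univ_le` hold at the cube `□_j` with the cube configuration `Ã_j = cubeVec j A`.
[cite: Balaban1983RegularityDecay, Lemma 2.2 (2.17) p.578, (2.20) p.578, Theorem p.573 «for e sufficiently small»]
[cite: Balaban1982Higgs1, Prop. 2.1 (2.23)–(2.25) pp.610–611] -/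
theorem cube_inputs (C : ChargeData N) (d0 ℓ0 : ℕ) (hℓ0 : 1 ≤ ℓ0) (amin aplus m2plus : ℝ) (ha : 0 < amin) :
    ∃ Cγ Cβ : ℝ, 0 < Cγ ∧ 0 < Cβ ∧ ∀ (creg β : ℝ), 0 ≤ creg → 0 < β → ∀ (K₀ : ℕ), 8 ≤ K₀ →
      ∃ e₁ : ℝ, 0 < e₁ ∧ ∀ (P : HiggsLattice.Params), dd P = d0 → P.L - 1 = ℓ0 →
        ∀ (K : ℕ), 1 ≤ K → K ≤ P.K → K₀ ∣ P.M → (∀ μ, 3 * half P K K₀ ≤ P.sitesPerDir 0 μ) →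
        ∀ (a msq : ℝ), amin ≤ a → a ≤ aplus → 0 < msq → msq * P.mesh K ^ 2 ≤ m2plus →
        ∀ (j : Lab P K K₀) (A : HiggsLattice.VecField P 0) (ec : ℝ), 0 < ec → ec ≤ e₁ →
          (∀ y ∈ Box (dd P) (P.L - 1) K (M2 P K₀), ∀ i i' : Fin (dd P + 1),
            |acT K K₀ j ((((P.L - 1 + 1) ^ K : ℕ) : ℝ) * P.mesh 0 * C.e / ec) A (y + e1 i) i'
              - acT K K₀ j ((((P.L - 1 + 1) ^ K : ℕ) : ℝ) * P.mesh 0 * C.e / ec) A y i'|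
              ≤ creg * ec ^ (β - 1) / ((P.L - 1 + 1) ^ K : ℕ)) →
          (∀ ψ : HiggsLattice.ScalarField P 0 N,
              ‖propagatorK C (cube K K₀ j) (cubeVec K K₀ j A) msq a K (hTor K K₀ j • ψ)‖ ≤ Cγ * P.mesh K ^ 2 * ‖ψ‖) ∧
          (∀ ψ : HiggsLattice.ScalarField P 0 N,
              ‖covOpK C (cube K K₀ j) (cubeVec K K₀ j A) msq a K
                  (hTor K K₀ j • propagatorK C (cube K K₀ j) (cubeVec K K₀ j A) msq a K (hTor K K₀ j • ψ))
                - hTor K K₀ j • covOpK C (cube K K₀ j) (cubeVec K K₀ j A) msq a K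
                  (propagatorK C (cube K K₀ j) (cubeVec K K₀ j A) msq a K (hTor K K₀ j • ψ))‖ ≤ Cβ / K₀ * ‖ψ‖) := by
  classical
  -- the constants of Lemma 2.2 at charge 1, generic contour systems
  obtain ⟨c, hc, hLβ⟩ := eq220_sup_box (flowC C) (ellC_nonneg C) (flowC_lipschitz C) 1 d0 ℓ0 hℓ0 amin aplus m2plus ha
  obtain ⟨c', hc', hLγ⟩ := lemma22_17_sup_box (flowC C) (ellC_nonneg C) (flowC_lipschitz C) 1 d0 ℓ0 hℓ0 amin aplus m2plus ha
  by_cases hapl : aplus < amin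
  · refine ⟨1, 1, one_pos, one_pos, fun creg β _ _ K₀ _ => ⟨1, one_pos, ?_⟩⟩
    intro P _ _ K _ _ _ _ a msq e1' e2
    exact absurd (e1'.trans e2) (not_le.2 hapl)
  rw [not_lt] at hapl
  have hapl0 : 0 ≤ aplus := ha.le.trans hapl
  have hℓ₁ : 0 ≤ ellC C := ellC_nonneg C
  have hD1 := D1_nonneg contDiff_hprof hasCompactSupport_hprof
  have hD2 := D2_nonneg contDiff_hprof hasCompactSupport_hprof
  set D : ℝ := ((d0 : ℝ) + 1) * (D1 hprof + D2 hprof) with hD_def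
  have hD : 0 ≤ D := by positivity
  set Cβ : ℝ := (2 * ((d0 : ℝ) + 1) * (1 + ellC C) + 1 + aplus) * (D + 1) * (2 * (((d0 : ℝ) + 2) * c)) with hCβ_def
  set Cγ : ℝ := 2 * (((d0 : ℝ) + 2) * c') with hCγ_def
  have hCβ0 : 0 < Cβ := by positivity
  have hCγ0 : 0 < Cγ := by positivity
  refine ⟨Cγ, Cβ, hCγ0, hCβ0, fun creg β hcreg hβ K₀ hK₀8 => ?_⟩
  have hcc : 0 ≤ max c c' := hc.le.trans (le_max_left _ _)
  obtain ⟨e₁, he₁, hth⟩ := cubeField_threshold d0 (aplus := aplus) hℓ₁ hcc ha hcreg hβ (2 * K₀) K₀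
  refine ⟨e₁, he₁, ?_⟩
  intro P hd hl K hK1 hK hK₀ hN3 a msq e1' e2 hmsq e4 j A ec hec hle h17
  subst hd; subst hl
  -- the instance
  have hK₀' : 1 ≤ K₀ := le_trans (by norm_num) hK₀8
  have hℓ : 1 ≤ P.L - 1 := hℓ0
  have hL2 : 2 ≤ P.L := by omega
  have hn : 1 ≤ (P.L - 1 + 1) ^ K := one_le_n P K
  have hn2 : 2 ≤ (P.L - 1 + 1) ^ K := by
    calc 2 ≤ P.L - 1 + 1 := by omega
      _ = (P.L - 1 + 1) ^ 1 := (pow_one _).symm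
      _ ≤ (P.L - 1 + 1) ^ K := Nat.pow_le_pow_right (by omega) hK1
  have hnK : 16 ≤ (P.L - 1 + 1) ^ K * K₀ := by nlinarith
  have hnK3 : 3 ≤ (P.L - 1 + 1) ^ K * K₀ := le_trans (by norm_num) hnK
  have hnr : (0 : ℝ) < (((P.L - 1 + 1) ^ K : ℕ) : ℝ) := by exact_mod_cast hn
  have hM : ∀ i, 1 ≤ M2 P K₀ i := fun i => by unfold M2; omega
  have hS : ∀ i, M2 P K₀ i ≤ 2 * K₀ := fun i => le_rfl
  have hKM : ∀ μ, K₀ ∣ M2 P K₀ μ := fun μ => ⟨2, by unfold M2; ring⟩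
  have hjlo : ∀ μ : Fin (dd P + 1), (1 : ℤ) ≤ (fun _ : Fin (dd P + 1) => (1 : ℤ)) μ := fun μ => le_rfl
  have hjhi : ∀ μ : Fin (dd P + 1), (K₀ : ℤ) * ((fun _ : Fin (dd P + 1) => (1 : ℤ)) μ + 1) ≤ M2 P K₀ μ := by
    intro μ; unfold M2; push_cast; linarith
  have ha' : 0 < a := lt_of_lt_of_le ha e1'
  have hm2 : 0 ≤ msq * P.mesh K ^ 2 := by positivity
  have hmeshK : 0 < P.mesh K := by unfold HiggsLattice.Params.mesh; have := P.hε; have := P.hL; positivity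
  obtain ⟨hak1, hak2⟩ := aSeq_window hℓ hK1 ha e1' e2
  have hak0 : 0 ≤ B1.aSeq a (((P.L - 1 : ℕ) : ℝ) + 1) K := by linarith
  have hakP : 0 ≤ B1.aSeq a P.L K := aSeq_nonneg_model hL2 ha' hK1
  -- the scaled field and the coupling `κ = e_c/n`, `κσ = εe`
  set σ : ℝ := (((P.L - 1 + 1) ^ K : ℕ) : ℝ) * P.mesh 0 * C.e / ec with hσ
  have hκσ : ec / (((P.L - 1 + 1) ^ K : ℕ) : ℝ) * σ = P.mesh 0 * C.e := by
    rw [hσ]; field_simp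
  obtain ⟨hθ1, hsm2, hsm⟩ := hth ec hec hle _ hak1 hak2
  obtain ⟨hanti', hA', hder, hbd⟩ :=
    cubeField_hyps (d := dd P) hn hS hK₀' hnK hjlo hjhi hcreg hec h17 (β := β)
  -- contour-system facts for the lineage
  have hend' : ∀ y x, blkWt ((P.L - 1 + 1) ^ K) (M2 P K₀) (fun i => (P.L - 1 + 1) ^ K * M2 P K₀ i) y x ≠ 0 →
      pathEnd (baseEmb (one_le_n P K) (M2 P K₀) y) (gammaT P K K₀ y x) = x := fun y x h => gammaT_hend y x h
  have hnn' : ∀ y x, blkWt ((P.L - 1 + 1) ^ K) (M2 P K₀) (fun i => (P.L - 1 + 1) ^ K * M2 P K₀ i) y x ≠ 0 →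
      PathRel (fun u v : ↥(Box (dd P) (P.L - 1) K (M2 P K₀)) => v.1 ∈ nbrs u.1)
        (baseEmb (one_le_n P K) (M2 P K₀) y) (gammaT P K K₀ y x) := fun y x _ => gammaT_nn y x
  -- the quantities θ, θ', τ of the lineage
  set θ : ℝ := ((dd P : ℝ) + 1) * ((2 * K₀ : ℕ) : ℝ) * creg * ec ^ β with hθ_def
  set θ' : ℝ := creg * ec ^ β * (1 + D1 thetaProf * (((dd P : ℝ) + 1) * ((2 * K₀ : ℕ) : ℝ)) / K₀) with hθ'_def
  have hθ0 : 0 ≤ θ := by have := (Real.rpow_pos_of_pos hec β).le; positivity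
  have hθ'0 : 0 ≤ θ' := by
    have := (Real.rpow_pos_of_pos hec β).le
    have := D1_nonneg contDiff_thetaProf hasCompactSupport_thetaProf
    positivity
  set A₀' : Fin (dd P + 1) → ℝ := fun μ => ec / (((P.L - 1 + 1) ^ K : ℕ) : ℝ) * acT K K₀ j σ A 0 μ with hA₀'
  set A' : ↥(Box (dd P) (P.L - 1) K (M2 P K₀)) → ↥(Box (dd P) (P.L - 1) K (M2 P K₀)) → ℝ := fun u v =>
    ec / (((P.L - 1 + 1) ^ K : ℕ) : ℝ) * cubeFluct (Box (dd P) (P.L - 1) K (M2 P K₀)) ((P.L - 1 + 1) ^ K) K₀ (fun _ => 1)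
      (acT K K₀ j σ A 0) (acT K K₀ j σ A) u v with hA'_def
  have hfield : (fun u v => ec / (((P.L - 1 + 1) ^ K : ℕ) : ℝ) * boxField K K₀ j σ A u v)
      = constBond A₀' Subtype.val + A' :=
    smul_cubeField _ _ _ _ _ _
  have hunit : IsUnit (opA (dd P) (flowC C) 1 (P.L - 1) K a (msq * P.mesh K ^ 2) (M2 P K₀)
      (baseEmb (one_le_n P K) (M2 P K₀)) (gammaT P K K₀) (constBond A₀' Subtype.val + A')).det :=
    opA_isUnit_det (flowC C) 1 hℓ hK1 ha' hm2 (M2 P K₀) hnn' hend' _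
  have hτ : ∀ y x, blkWt ((P.L - 1 + 1) ^ K) (M2 P K₀) (fun i => (P.L - 1 + 1) ^ K * M2 P K₀ i) y x ≠ 0 →
      |1 * lsum A' (baseEmb (one_le_n P K) (M2 P K₀) y) (gammaT P K K₀ y x)| ≤ ((dd P : ℝ) + 1) * θ := by
    intro y x _
    have h1 := abs_lsum_le (r := fun u v : ↥(Box (dd P) (P.L - 1) K (M2 P K₀)) => v.1 ∈ nbrs u.1) (κ := 1) (B := A')
      (ρ := θ / ((P.L - 1 + 1) ^ K : ℕ)) (fun u v huv => hA' u v huv) _ _ (gammaT_nn y x)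
    have hlen := length_gammaT_le y x
    have hlenR : ((gammaT P K K₀ y x).length : ℝ) ≤ ((dd P : ℝ) + 1) * ((((P.L - 1 + 1) ^ K : ℕ) : ℝ) - 1) := by
      rw [predL_succ]
      have : (((gammaT P K K₀ y x).length : ℤ) : ℝ) ≤ ((((dd P : ℤ) + 1) * ((P.L : ℤ) ^ K - 1) : ℤ) : ℝ) := by
        exact_mod_cast hlen
      push_cast at this ⊢
      exact this
    refine h1.trans ?_
    rw [div_eq_mul_inv]
    have hθn : 0 ≤ θ * ((((P.L - 1 + 1) ^ K : ℕ) : ℝ))⁻¹ := by positivity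
    calc ((gammaT P K K₀ y x).length : ℝ) * (θ * ((((P.L - 1 + 1) ^ K : ℕ) : ℝ))⁻¹)
        ≤ ((dd P : ℝ) + 1) * ((((P.L - 1 + 1) ^ K : ℕ) : ℝ) - 1) * (θ * ((((P.L - 1 + 1) ^ K : ℕ) : ℝ))⁻¹) :=
          mul_le_mul_of_nonneg_right hlenR hθn
      _ = ((dd P : ℝ) + 1) * θ * (((((P.L - 1 + 1) ^ K : ℕ) : ℝ) - 1) * ((((P.L - 1 + 1) ^ K : ℕ) : ℝ))⁻¹) := by ring
      _ ≤ ((dd P : ℝ) + 1) * θ * 1 := by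
          refine mul_le_mul_of_nonneg_left ?_ (by positivity)
          rw [← div_eq_mul_inv, div_le_one hnr]; linarith
      _ = ((dd P : ℝ) + 1) * θ := mul_one _
  have hτ0 : 0 ≤ ((dd P : ℝ) + 1) * θ := by positivity
  -- the two smallness conditions (for `c` and for `c'`) from the common threshold at `max c c'`
  have hX : 0 ≤ ((dd P : ℝ) + 1) * ellC C * (θ + θ') + ((dd P : ℝ) + 1) * ellC C * θ
      + ((dd P : ℝ) + 1) * ellC C ^ 2 * θ ^ 2
      + B1.aSeq a (((P.L - 1 : ℕ) : ℝ) + 1) K * (ellC C * (((dd P : ℝ) + 1) * θ) * (2 + ellC C * (((dd P : ℝ) + 1) * θ))) := by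
    positivity
  have hsmβ : ((dd P : ℝ) + 2) * c * (((dd P : ℝ) + 1) * ellC C * (θ + θ') + ((dd P : ℝ) + 1) * ellC C * θ
      + ((dd P : ℝ) + 1) * ellC C ^ 2 * θ ^ 2
      + B1.aSeq a (((P.L - 1 : ℕ) : ℝ) + 1) K * (ellC C * (((dd P : ℝ) + 1) * θ) * (2 + ellC C * (((dd P : ℝ) + 1) * θ))))
      ≤ 1 / 2 := by
    refine le_trans ?_ hsm
    exact mul_le_mul_of_nonneg_right (mul_le_mul_of_nonneg_left (le_max_left _ _) (by positivity)) hX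
  have hsmγ : ((dd P : ℝ) + 2) * c' * (((dd P : ℝ) + 1) * ellC C * (θ + θ') + ((dd P : ℝ) + 1) * ellC C * θ
      + ((dd P : ℝ) + 1) * ellC C ^ 2 * θ ^ 2
      + B1.aSeq a (((P.L - 1 : ℕ) : ℝ) + 1) K * (ellC C * (((dd P : ℝ) + 1) * θ) * (2 + ellC C * (((dd P : ℝ) + 1) * θ))))
      ≤ 1 / 2 := by
    refine le_trans ?_ hsm
    exact mul_le_mul_of_nonneg_right (mul_le_mul_of_nonneg_left (le_max_right _ _) (by positivity)) hX
  have hHS := hsize_hBox (d := dd P) hn hK₀' hnK3 hKM (fun _ : Fin (dd P + 1) => (1 : ℤ))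
  -- the conversion `κ = e_c/n ↦ κ = 1`
  have hconvG : greenA (dd P) (flowC C) (ec / (((P.L - 1 + 1) ^ K : ℕ) : ℝ)) (P.L - 1) K a (msq * P.mesh K ^ 2) (M2 P K₀)
      (baseEmb (one_le_n P K) (M2 P K₀)) (gammaT P K K₀) (boxField K K₀ j σ A)
      = greenA (dd P) (flowC C) 1 (P.L - 1) K a (msq * P.mesh K ^ 2) (M2 P K₀)
        (baseEmb (one_le_n P K) (M2 P K₀)) (gammaT P K K₀) (constBond A₀' Subtype.val + A') := by
    rw [greenA_smul, hfield]
  have hconvK : kOp (flowC C) (ec / (((P.L - 1 + 1) ^ K : ℕ) : ℝ)) ((P.L - 1 + 1) ^ K)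
      (B1.aSeq a (((P.L - 1 : ℕ) : ℝ) + 1) K) (msq * P.mesh K ^ 2) (M2 P K₀) (baseEmb (one_le_n P K) (M2 P K₀))
      (gammaT P K K₀) (boxField K K₀ j σ A) (hBox ((P.L - 1 + 1) ^ K) K₀ (M2 P K₀) (fun _ => 1))
      = kOp (flowC C) 1 ((P.L - 1 + 1) ^ K) (B1.aSeq a (((P.L - 1 : ℕ) : ℝ) + 1) K) (msq * P.mesh K ^ 2) (M2 P K₀)
        (baseEmb (one_le_n P K) (M2 P K₀)) (gammaT P K K₀) (constBond A₀' Subtype.val + A')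
        (hBox ((P.L - 1 + 1) ^ K) K₀ (M2 P K₀) (fun _ => 1)) := by
    rw [kOp_smul, hfield]
  -- supports
  have hGsupp : ∀ φ : HiggsLattice.ScalarField P 0 N, ∀ x, x ∉ cube K K₀ j →
      propagatorK C (cube K K₀ j) (cubeVec K K₀ j A) msq a K (hTor K K₀ j • φ) x = 0 := fun φ x hx =>
    propagatorK_cube_supported C hK hK₀ hK₀' hN3 j _ hmsq a hakP (fun x' hx' => hTor_smul_eq_zero_off hK hK₀ hK₀8 j φ hx') hx
  constructor
  · -- (2.17): `‖G_j(h_jψ)‖ ≤ Cγ(L^Kε)²‖ψ‖`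
    intro ψ
    have main := (hLγ K hK1 a _ e1' e2 hm2 e4 (M2 P K₀) hM (baseEmb (one_le_n P K) (M2 P K₀)) (gammaT P K K₀) hend'
      A₀' A' θ θ' (((dd P : ℝ) + 1) * θ) hunit hθ0 hA' hθ'0 hder hbd hτ0 hτ hsmγ
      (mulH (hBox ((P.L - 1 + 1) ^ K) K₀ (M2 P K₀) (fun _ => 1)) *ᵥ pull K K₀ j ψ)).1
    have hsum : 0 ≤ ∑ μ, supN (B4Lemma22ReduceZero.derivA0 (dd P) (flowC C) 1 (P.L - 1) K (M2 P K₀) A₀' μ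
        *ᵥ (greenA (dd P) (flowC C) 1 (P.L - 1) K a (msq * P.mesh K ^ 2) (M2 P K₀)
          (baseEmb (one_le_n P K) (M2 P K₀)) (gammaT P K K₀) (constBond A₀' Subtype.val + A')
            *ᵥ (mulH (hBox ((P.L - 1 + 1) ^ K) K₀ (M2 P K₀) (fun _ => 1)) *ᵥ pull K K₀ j ψ))) :=
      Finset.sum_nonneg fun μ _ => supN_nonneg _
    have hG : supN (greenA (dd P) (flowC C) 1 (P.L - 1) K a (msq * P.mesh K ^ 2) (M2 P K₀)
        (baseEmb (one_le_n P K) (M2 P K₀)) (gammaT P K K₀) (constBond A₀' Subtype.val + A')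
          *ᵥ (mulH (hBox ((P.L - 1 + 1) ^ K) K₀ (M2 P K₀) (fun _ => 1)) *ᵥ pull K K₀ j ψ))
        ≤ Cγ * supN (mulH (hBox ((P.L - 1 + 1) ^ K) K₀ (M2 P K₀) (fun _ => 1)) *ᵥ pull K K₀ j ψ) := by
      rw [hCγ_def]; linarith
    rw [norm_eq_supN_pull hK hK₀ hK₀' j (hGsupp ψ), pull_propagatorK C hK hK1 hK₀ hK₀8 hN3 hL2 j hκσ ha' hmsq A,
      pull_hsmul_hTor hK hK₀ hK₀' j ψ, hconvG]
    calc supN (P.mesh K ^ 2 • (greenA (dd P) (flowC C) 1 (P.L - 1) K a (msq * P.mesh K ^ 2) (M2 P K₀)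
          (baseEmb (one_le_n P K) (M2 P K₀)) (gammaT P K K₀) (constBond A₀' Subtype.val + A')
            *ᵥ (mulH (hBox ((P.L - 1 + 1) ^ K) K₀ (M2 P K₀) (fun _ => 1)) *ᵥ pull K K₀ j ψ)))
        ≤ |P.mesh K ^ 2| * supN (greenA (dd P) (flowC C) 1 (P.L - 1) K a (msq * P.mesh K ^ 2) (M2 P K₀)
          (baseEmb (one_le_n P K) (M2 P K₀)) (gammaT P K K₀) (constBond A₀' Subtype.val + A')
            *ᵥ (mulH (hBox ((P.L - 1 + 1) ^ K) K₀ (M2 P K₀) (fun _ => 1)) *ᵥ pull K K₀ j ψ)) := supN_smul_le _ _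
      _ ≤ |P.mesh K ^ 2| * (Cγ * supN (pull K K₀ j ψ)) := by
          refine mul_le_mul_of_nonneg_left (hG.trans ?_) (abs_nonneg _)
          exact mul_le_mul_of_nonneg_left (supN_mulH_le hHS.abs_le _) hCγ0.le
      _ ≤ |P.mesh K ^ 2| * (Cγ * ‖ψ‖) :=
          mul_le_mul_of_nonneg_left (mul_le_mul_of_nonneg_left (supN_pull_le j ψ) hCγ0.le) (abs_nonneg _)
      _ = Cγ * P.mesh K ^ 2 * ‖ψ‖ := by rw [abs_of_nonneg (by positivity)]; ring
  · -- (2.20): `‖K_jG_j(h_jψ)‖ ≤ (Cβ/K₀)‖ψ‖`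
    intro ψ
    have main := hLβ K hK1 a _ e1' e2 hm2 e4 (M2 P K₀) hM (baseEmb (one_le_n P K) (M2 P K₀)) (gammaT P K K₀) hend'
      A₀' A' θ θ' (((dd P : ℝ) + 1) * θ) hanti' hunit hθ0 hA' hθ'0 hder hbd hτ0 hτ hsmβ _ _ _
      (hBox ((P.L - 1 + 1) ^ K) K₀ (M2 P K₀) (fun _ => 1)) hHS (pull K K₀ j ψ)
    set u := propagatorK C (cube K K₀ j) (cubeVec K K₀ j A) msq a K (hTor K K₀ j • ψ) with hu_def
    have hu : pull K K₀ j u = P.mesh K ^ 2 • (greenA (dd P) (flowC C) (ec / (((P.L - 1 + 1) ^ K : ℕ) : ℝ)) (P.L - 1) K a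
        (msq * P.mesh K ^ 2) (M2 P K₀) (baseEmb (one_le_n P K) (M2 P K₀)) (gammaT P K K₀) (boxField K K₀ j σ A)
          *ᵥ (mulH (hBox ((P.L - 1 + 1) ^ K) K₀ (M2 P K₀) (fun _ => 1)) *ᵥ pull K K₀ j ψ)) := by
      rw [hu_def, pull_propagatorK C hK hK1 hK₀ hK₀8 hN3 hL2 j hκσ ha' hmsq A, pull_hsmul_hTor hK hK₀ hK₀' j ψ]
    have hv := pull_commutator C hK hK₀ hK₀8 hN3 j hκσ a msq A u
    -- support of the commutator field
    have husupp : ∀ x, x ∉ cube K K₀ j → u x = 0 := hGsupp ψ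
    have hvsupp : ∀ x, x ∉ cube K K₀ j →
        (covOpK C (cube K K₀ j) (cubeVec K K₀ j A) msq a K (hTor K K₀ j • u)
          - hTor K K₀ j • covOpK C (cube K K₀ j) (cubeVec K K₀ j A) msq a K u) x = 0 := by
      intro x hx
      rw [Pi.sub_apply, covOpK_cube_apply_eq_zero_of_in C hK hK₀ hK₀' hN3 j _ msq a
        (fun x' hx' => hTor_smul_eq_zero_off hK hK₀ hK₀8 j u hx') hx, hTor_smul_eq_zero_off hK hK₀ hK₀8 j _ hx, sub_zero]
    have hs0 : P.mesh K ^ 2 ≠ 0 := by positivity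
    rw [norm_eq_supN_pull hK hK₀ hK₀' j hvsupp, hv, hu, Matrix.mulVec_smul, smul_smul, inv_mul_cancel₀ hs0, one_smul,
      supN_neg, hconvK, hconvG]
    refine main.trans ?_
    -- the constant: `(2(d+1)(1+ℓ₁θ)δ₁ + δ₂ + a_kδ₃)·2(d+2)c ≤ Cβ/K₀` with `δ₁ = δ₃ = D/K₀`, `δ₂ = D/K₀²`
    have hKr : (1 : ℝ) ≤ K₀ := by exact_mod_cast hK₀'
    have hKpos : (0 : ℝ) < K₀ := by linarith
    have hψ0 := supN_nonneg (pull K K₀ j ψ)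
    have hcoef : (2 * ((dd P : ℝ) + 1) * (1 + ellC C * θ) * (((dd P : ℝ) + 1) * (D1 hprof + D2 hprof) / K₀)
        + ((dd P : ℝ) + 1) * (D1 hprof + D2 hprof) / (K₀ : ℝ) ^ 2
        + B1.aSeq a (((P.L - 1 : ℕ) : ℝ) + 1) K * (((dd P : ℝ) + 1) * (D1 hprof + D2 hprof) / K₀))
        * (2 * (((dd P : ℝ) + 2) * c)) ≤ Cβ / K₀ := by
      rw [hCβ_def, ← hD_def]
      have h1 : ellC C * θ ≤ ellC C := mul_le_of_le_one_right hℓ₁ hθ1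
      have hKsq : (K₀ : ℝ) ≤ (K₀ : ℝ) ^ 2 := by rw [sq]; exact le_mul_of_one_le_left hKpos.le hKr
      have h2 : D / (K₀ : ℝ) ^ 2 ≤ D / K₀ := div_le_div_of_nonneg_left hD hKpos hKsq
      have h3 : B1.aSeq a (((P.L - 1 : ℕ) : ℝ) + 1) K * (D / K₀) ≤ aplus * (D / K₀) :=
        mul_le_mul_of_nonneg_right hak2 (by positivity)
      have h4 : 2 * ((dd P : ℝ) + 1) * (1 + ellC C * θ) * (D / K₀) ≤ 2 * ((dd P : ℝ) + 1) * (1 + ellC C) * (D / K₀) :=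
        mul_le_mul_of_nonneg_right (mul_le_mul_of_nonneg_left ((add_le_add_iff_left 1).2 h1) (by positivity)) (by positivity)
      have h5 : (2 * ((dd P : ℝ) + 1) * (1 + ellC C) + 1 + aplus) * (D / K₀)
          ≤ (2 * ((dd P : ℝ) + 1) * (1 + ellC C) + 1 + aplus) * ((D + 1) / K₀) :=
        mul_le_mul_of_nonneg_left (div_le_div_of_nonneg_right (by linarith) hKpos.le) (by positivity)
      calc (2 * ((dd P : ℝ) + 1) * (1 + ellC C * θ) * (D / K₀) + D / (K₀ : ℝ) ^ 2
            + B1.aSeq a (((P.L - 1 : ℕ) : ℝ) + 1) K * (D / K₀)) * (2 * (((dd P : ℝ) + 2) * c))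
          ≤ ((2 * ((dd P : ℝ) + 1) * (1 + ellC C) + 1 + aplus) * ((D + 1) / K₀)) * (2 * (((dd P : ℝ) + 2) * c)) := by
            refine mul_le_mul_of_nonneg_right ?_ (by positivity)
            calc 2 * ((dd P : ℝ) + 1) * (1 + ellC C * θ) * (D / K₀) + D / (K₀ : ℝ) ^ 2
                  + B1.aSeq a (((P.L - 1 : ℕ) : ℝ) + 1) K * (D / K₀)
                ≤ 2 * ((dd P : ℝ) + 1) * (1 + ellC C) * (D / K₀) + D / K₀ + aplus * (D / K₀) :=
                  add_le_add (add_le_add h4 h2) h3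
              _ = (2 * ((dd P : ℝ) + 1) * (1 + ellC C) + 1 + aplus) * (D / K₀) := by ring
              _ ≤ _ := h5
        _ = (2 * ((dd P : ℝ) + 1) * (1 + ellC C) + 1 + aplus) * (D + 1) * (2 * (((dd P : ℝ) + 2) * c)) / K₀ := by ring
    calc (2 * ((dd P : ℝ) + 1) * (1 + ellC C * θ) * (((dd P : ℝ) + 1) * (D1 hprof + D2 hprof) / K₀)
          + ((dd P : ℝ) + 1) * (D1 hprof + D2 hprof) / (K₀ : ℝ) ^ 2
          + B1.aSeq a (((P.L - 1 : ℕ) : ℝ) + 1) K * (((dd P : ℝ) + 1) * (D1 hprof + D2 hprof) / K₀))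
          * (2 * (((dd P : ℝ) + 2) * c)) * supN (pull K K₀ j ψ)
        ≤ Cβ / K₀ * supN (pull K K₀ j ψ) := mul_le_mul_of_nonneg_right hcoef hψ0
      _ ≤ Cβ / K₀ * ‖ψ‖ := mul_le_mul_of_nonneg_left (supN_pull_le j ψ) (by positivity)

end Inputs

end Literature.MathematicalPhysics.QuantumFieldTheory.Balaban1983to89.B1TorusCubeBoxOp
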